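import Literature.Topology.PlanarFoliations.HugState
import Literature.Topology.PlanarFoliations.WalkFencePrefix
import Literature.Topology.PlanarFoliations.LeafIccPath
import HarnessLib

/-!
# The hugged walk: darts, canonical states, junctions and links

Topic: Topology / PlanarFoliations, sequel to `HugState.lean` (frontier separatrices of the limit
set `Dlim` of a chain of compact leaves, under the standing hypotheses `HugHyp`: no compact
frontier leaf), `WalkFencePrefix.lean` (walk fences over prefixes), `LeafIccPath.lean` (leaf arcs
as paths). We set up the **walk along the frontier separatrices hugged by the compact leaves of
the chain** (Camacho–Lins Neto, Ch. VII §2: the curves `∂Vₙ` accumulate on a graph of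
separatrices, followed saddle after saddle by turning to one side):

* `StarData.Dart` (**structure**; `Finite`): a saddle `v` and a prong `j`; `Dart.turn s` the dart
  of the neighbouring prong on the side `s`; `Dart.exitPt` the **canonical point** of `X` over the
  end `pt j (ρ, 0)` of the prong arc; `Dart.Good` (**structure**, `Prop`): the exit point is a
  frontier point, its (line) leaf has α-limit set `{v}` and the whole prong arc is a backward tail;
* `StarData.HugData` (**structure**): a state (`HugState`: a frontier point) with a chosen forward
  tail `E` at its arrival saddle; `HugState.canonData` the **canonical** data of a state (the tail
  chosen beyond the base point); `HugData.junction s` (**definition**): the walk junction at the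
  arrival saddle — `jin = E.j`, `jout` by the turning rule, a parameter `β` below `E.β₀ / 2` and
  below the prong-box bounds of `jin`, `jin ± 1` (so that `β` and `Kin` do not depend on `s`), and
  chosen prong boxes;
* `HugData.next s hg` (**definition**): for a good out-dart, the canonical data of the exit point —
  it depends on the state only through its out-dart (`next_eq_of_outDart_eq`), the key to the
  periodicity of the hugged walk; `HugData.seq s d₀` (**definition**): the sequence of states
  (`next` while good, constant after); `HugData.link` (**definition**, leaf arc from `Kout.base` to
  the next `Kin.base` in the leaf of the next state, `linkStart_lt_linkEnd` **proved**: the tails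
  are chosen apart) and `WalkJunction.junkPath` (a path inside the star, used at the indices that
  are not yet known to be good); `StarData.hugJ`, `StarData.hugLink` (**definitions**): the total
  junction and link sequences fed to `walkFencePrefix`, with `hugJ_turn` (`rfl`) and
  `continuous_toLeafSpace_hugLink` (**proved** at good indices).

The inductive step (every state is good) is `HugStep.lean`.

## References

* C. Camacho, A. Lins Neto, *Geometric Theory of Foliations*, Birkhäuser (1985), Ch. VII §2
  [CamachoLinsNeto1985].
-/

noncomputable section

open Set Filter Function Metric unitInterval
open _root_.Topology
open Literature.Topology.FourManifolds Literature.Topology.FourManifolds.Foliation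

namespace Literature.Topology.PlanarFoliations

variable {X : Type*} [TopologicalSpace X] [T2Space X] [SecondCountableTopology X] [Nonempty X] {F : Foliation ℝ X} {ι : X → ℂ}
variable {B : Type*} [NormedAddCommGroup B] {M : Type*} [TopologicalSpace M] {T : Foliation B M} {g : ℂ → M}

namespace StarData

variable (D : StarData F ι T g) (hι : IsOpenEmbedding ι)

/-! ## Darts -/

/-- **A dart of the separatrix graph**: a saddle puncture and one of its prongs. [folklore] -/
structure Dart where
  /-- the saddle -/
  v : ℂ
  hv : D.nprong v ≠ 0
  /-- the prong -/
  j : ZMod (D.nprong v)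

variable {D}

namespace Dart

omit [T2Space X] [SecondCountableTopology X] [Nonempty X] in
/-- Extensionality of darts. [folklore] -/
theorem ext' {dt dt' : D.Dart} (hv : dt.v = dt'.v) (hj : dt.j.val = dt'.j.val) : dt = dt' := by
  obtain ⟨v, hv0, j⟩ := dt
  obtain ⟨v', hv0', j'⟩ := dt'
  simp only at hv hj
  subst hv
  haveI : NeZero (D.nprong v) := ⟨hv0⟩
  have : j = j' := ZMod.val_injective _ hj
  subst this
  rfl

omit [T2Space X] [SecondCountableTopology X] [Nonempty X] in
/-- **There are finitely many darts.** [folklore] -/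
theorem finite : Finite D.Dart := by
  haveI : Finite {v : ℂ // D.nprong v ≠ 0} :=
    (D.P_finite.subset (fun v (hv : D.nprong v ≠ 0) ↦ D.mem_P v hv)).to_subtype
  haveI : ∀ v : {v : ℂ // D.nprong v ≠ 0}, Finite (ZMod (D.nprong v.1)) := fun v ↦
    haveI : NeZero (D.nprong v.1) := ⟨v.2⟩; inferInstance
  refine Finite.of_injective
    (fun dt : D.Dart ↦ (⟨⟨dt.v, dt.hv⟩, dt.j⟩ : Σ v : {v : ℂ // D.nprong v ≠ 0}, ZMod (D.nprong v.1))) ?_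
  rintro ⟨v, hv, j⟩ ⟨v', hv', j'⟩ h
  simp only [Sigma.mk.injEq, Subtype.mk.injEq] at h
  obtain ⟨rfl, hj⟩ := h
  simp only [heq_eq_eq] at hj
  subst hj
  rfl

variable (dt : D.Dart)

/-- The star of the dart. [folklore] -/
abbrev P : ProngStar F ι dt.v (D.nprong dt.v) := D.star dt.v dt.hv

/-- **The turned dart** on the side `s`: the neighbouring prong `j + 1` if `0 ≤ sg j * s`, else
`j - 1` (the turning rule of `WalkJunction.turn`). [folklore] -/
def turn (s : ℝ) : D.Dart := ⟨dt.v, dt.hv, if 0 ≤ dt.P.sg dt.j * s then dt.j + 1 else dt.j - 1⟩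

omit [T2Space X] [SecondCountableTopology X] [Nonempty X] in
/-- The turned dart has the same saddle. [folklore] -/
@[simp] theorem turn_v (s : ℝ) : (dt.turn s).v = dt.v := rfl

omit [T2Space X] [SecondCountableTopology X] [Nonempty X] in
/-- The prong of the turned dart. [folklore] -/
theorem turn_j (s : ℝ) : (dt.turn s).j = if 0 ≤ dt.P.sg dt.j * s then dt.j + 1 else dt.j - 1 := rfl

/-- **The exit point** of the dart: the canonical point of `X` over the end `pt j (ρ, 0)` of the
prong arc. [folklore] -/
def exitPt : X := dt.P.horiz hι dt.j 0 dt.P.ρ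

omit [T2Space X] [SecondCountableTopology X] [Nonempty X] in
/-- The end of the prong arc has coordinates in the half square. [folklore] -/
theorem ρ_mem_rect : ((dt.P.ρ, (0 : ℝ)) : ℝ × ℝ) ∈ dt.P.rect :=
  (dt.P.mem_rect_iff).2 ⟨⟨dt.P.ρ_pos.le, le_rfl⟩, by simp [dt.P.ρ_pos.le]⟩

omit [T2Space X] [SecondCountableTopology X] [Nonempty X] in
/-- The end of the prong arc is not the origin of the coordinates. [folklore] -/
theorem ρ_ne_zero : ((dt.P.ρ, (0 : ℝ)) : ℝ × ℝ) ≠ 0 := fun h ↦ by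
  have := congrArg Prod.fst h; simp at this; exact dt.P.ρ_pos.ne' this

omit [T2Space X] [SecondCountableTopology X] in
/-- The exit point lies over the end of the prong arc. [folklore] -/
theorem ι_exitPt : ι (dt.exitPt hι) = dt.P.pt dt.j (dt.P.ρ, 0) :=
  dt.P.ι_horiz hι dt.ρ_mem_rect dt.ρ_ne_zero

omit [T2Space X] [SecondCountableTopology X] in
/-- The prong arc lies in the leaf of the exit point. [folklore] -/
theorem horiz_mem_leaf_exitPt {b : ℝ} (hb : b ∈ Ioc 0 dt.P.ρ) : dt.P.horiz hι dt.j 0 b ∈ F.leaf (dt.exitPt hι) :=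
  dt.P.horiz_mem_leaf' hι dt.ρ_mem_rect ((dt.P.mem_rect_iff).2 ⟨⟨hb.1.le, hb.2⟩, by simp [dt.P.ρ_pos.le]⟩)
    (Or.inr ⟨dt.P.ρ_pos, hb.1⟩)

/-- **A good dart**: its exit point is a frontier point of the limit set with line leaf, whose
α-limit set is the saddle, and the whole prong arc is a backward tail of that leaf. [folklore] -/
structure Good (hbi : IsBiOriented F) (K : ℕ → X) : Prop where
  /-- the leaf of the exit point is a line leaf -/
  nc : NoncompactSpace (F.Leaf (dt.exitPt hι))
  /-- the exit point is a frontier point -/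
  fr : ι (dt.exitPt hι) ∈ frontier (Dlim ι F K)
  /-- the α-limit set of its leaf is the saddle -/
  α : alphaSet hbi ι (dt.exitPt hι) = {dt.v}
  /-- the whole prong arc is a backward tail -/
  eb : ∃ Eb : dt.P.BwdTail hbi (dt.exitPt hι), Eb.j = dt.j ∧ Eb.β₀ = dt.P.ρ

end Dart

/-! ## States with a chosen arrival tail -/

variable {hbi : IsBiOriented F} {hι} {K : ℕ → X}

/-- **The data of a state of the hugged walk**: a frontier point and a forward tail of its leaf at
the arrival saddle. [folklore] -/
structure HugData (H : D.HugHyp hbi hι K) where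
  /-- the state -/
  st : HugState ι F K
  /-- the chosen arrival tail -/
  E : haveI := st.nc H; (D.star _ (st.hv H)).FwdTail hbi st.y

variable (H : D.HugHyp hbi hι K)

namespace HugState

variable (st : HugState ι F K)

omit [Nonempty X] in
/-- The arrival saddle is in the ω-limit set. [folklore] -/
theorem v_mem_omegaSet : haveI := st.nc H; st.v H ∈ omegaSet hbi ι st.y := by
  rw [st.omegaSet_eq H]; exact mem_singleton _

omit [Nonempty X] in
/-- **There is an arrival tail based after the base point.** [folklore] -/
theorem exists_fwdTail_gt :
    haveI := st.nc H; ∃ E : (D.star _ (st.hv H)).FwdTail hbi st.y, leafLT hbi (Leaf.base F st.y) E.p := by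
  haveI := st.nc H
  exact (st.Ef H).exists_gt hι (st.v_mem_omegaSet H) (Leaf.base F st.y)

/-- **The canonical data of a state**: the arrival tail chosen beyond the base point. [folklore] -/
def canonData : HugData H := ⟨st, (st.exists_fwdTail_gt H).choose⟩

omit [Nonempty X] in
/-- The canonical data have the given state. [folklore] -/
@[simp] theorem canonData_st : (st.canonData H).st = st := rfl

end HugState

namespace Dart

/-- **The next data of a good dart**: the canonical data of its exit point. [folklore] -/
def nextData (dt : D.Dart) (hg : dt.Good hι hbi K) : HugData H := HugState.canonData H ⟨dt.exitPt hι, hg.fr⟩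

/-- The point of the next data is the exit point. [folklore] -/
@[simp] theorem nextData_y (dt : D.Dart) (hg : dt.Good hι hbi K) : (dt.nextData H hg).st.y = dt.exitPt hι := rfl

end Dart

namespace HugData

variable {H} (d : HugData H)

/-- The arrival saddle. [folklore] -/
def v : ℂ := d.st.v H

omit [Nonempty X] in
/-- The arrival saddle is a saddle. [folklore] -/
theorem hv : D.nprong d.v ≠ 0 := d.st.hv H

/-- The number of prongs at the arrival saddle is not zero. [folklore] -/
instance : NeZero (D.nprong d.v) := ⟨d.hv⟩

/-- The star of the arrival saddle. [folklore] -/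
abbrev P : ProngStar F ι d.v (D.nprong d.v) := D.star _ d.hv

omit [Nonempty X] in
/-- The state's leaf is a line leaf (an instance keyed by the state data). [folklore] -/
instance nc : NoncompactSpace (F.Leaf d.st.y) := d.st.nc H

omit [Nonempty X] in
/-- The canonical tail is based after the base point. [folklore] -/
theorem _root_.Literature.Topology.PlanarFoliations.StarData.HugState.base_lt_canonData_p (st : HugState ι F K) :
    leafLT hbi (Leaf.base F (st.canonData H).st.y) (st.canonData H).E.p :=
  (st.exists_fwdTail_gt H).choose_spec

/-- **The arrival prong.** [folklore] -/
def jin : ZMod (D.nprong d.v) := d.E.j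

/-- **The arrival dart.** [folklore] -/
def dart : D.Dart := ⟨d.v, d.hv, d.jin⟩

/-- **The out-dart** on the side `s`. [folklore] -/
def outDart (s : ℝ) : D.Dart := d.dart.turn s

/-- **The outgoing prong** on the side `s`. [folklore] -/
def jout (s : ℝ) : ZMod (D.nprong d.v) := (d.outDart s).j

omit [Nonempty X] in
/-- The outgoing prong by the turning rule. [folklore] -/
theorem jout_eq (s : ℝ) : d.jout s = if 0 ≤ d.P.sg d.jin * s then d.jin + 1 else d.jin - 1 := rfl

omit [Nonempty X] in
/-- The outgoing prong is a neighbour of the arrival prong. [folklore] -/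
theorem jout_eq_or (s : ℝ) : d.jout s = d.jin + 1 ∨ d.jout s = d.jin - 1 := by
  rw [d.jout_eq]; split_ifs <;> simp

omit [Nonempty X] in
/-- The out-dart is at the arrival saddle. [folklore] -/
@[simp] theorem outDart_v (s : ℝ) : (d.outDart s).v = d.v := rfl

omit [Nonempty X] in
/-- The prong of the out-dart is the outgoing prong. [folklore] -/
@[simp] theorem outDart_j (s : ℝ) : (d.outDart s).j = d.jout s := rfl

omit [Nonempty X] in
/-- The arrival dart is at the arrival saddle. [folklore] -/
@[simp] theorem dart_v : d.dart.v = d.v := rfl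

omit [Nonempty X] in
/-- The prong of the arrival dart is the arrival prong. [folklore] -/
@[simp] theorem dart_j : d.dart.j = d.jin := rfl

omit [Nonempty X] in
/-- The arrival saddle is in the ω-limit set. [folklore] -/
theorem v_mem_omegaSet : d.v ∈ omegaSet hbi ι d.st.y := d.st.v_mem_omegaSet H

/-! ### The junction -/

/-- The prong-box bound at the prong `j`. [folklore] -/
def βbox (j : ZMod (D.nprong d.v)) : ℝ := (d.P.exists_prongBox hι j).choose

/-- The prong-box bound is positive, at most `ρ`, and prong boxes exist below it. [folklore] -/
theorem βbox_spec (j : ZMod (D.nprong d.v)) :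
    d.βbox j ∈ Ioc 0 d.P.ρ ∧ ∀ β ∈ Ioc 0 (d.βbox j), Nonempty (ProngBox d.P hι j β) :=
  (d.P.exists_prongBox hι j).choose_spec

/-- **The parameter of the junction**: below half the tail parameter and below the prong-box
bounds of `jin`, `jin + 1`, `jin - 1`. [folklore] -/
def β : ℝ := min (d.E.β₀ / 2) (min (d.βbox d.jin) (min (d.βbox (d.jin + 1)) (d.βbox (d.jin - 1))))

/-- The parameter of the junction is positive. [folklore] -/
theorem β_pos : 0 < d.β :=
  lt_min (half_pos d.E.hβ₀.1) (lt_min (d.βbox_spec _).1.1 (lt_min (d.βbox_spec _).1.1 (d.βbox_spec _).1.1))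

/-- The parameter of the junction is below the tail parameter. [folklore] -/
theorem β_lt_β₀ : d.β < d.E.β₀ := (min_le_left _ _).trans_lt (half_lt_self d.E.hβ₀.1)

/-- The parameter of the junction is in `(0, β₀]`. [folklore] -/
theorem β_mem_Ioc : d.β ∈ Ioc 0 d.E.β₀ := ⟨d.β_pos, d.β_lt_β₀.le⟩

/-- The parameter of the junction is below `ρ`. [folklore] -/
theorem β_lt_ρ : d.β < d.P.ρ := d.β_lt_β₀.trans_le d.E.hβ₀.2

/-- The parameter of the junction is in `(0, ρ)`. [folklore] -/
theorem β_mem_Ioo : d.β ∈ Ioo 0 d.P.ρ := ⟨d.β_pos, d.β_lt_ρ⟩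

/-- The parameter of the junction is in `(0, ρ]`. [folklore] -/
theorem β_mem_Ioc_ρ : d.β ∈ Ioc 0 d.P.ρ := ⟨d.β_pos, d.β_lt_ρ.le⟩

/-- The parameter of the junction is in `[0, ρ]`. [folklore] -/
theorem hβ : d.β ∈ Icc 0 d.P.ρ := ⟨d.β_pos.le, d.β_lt_ρ.le⟩

/-- The parameter of the junction is below the prong-box bound of `jin`. [folklore] -/
theorem β_le_βbox_jin : d.β ≤ d.βbox d.jin := (min_le_right _ _).trans (min_le_left _ _)

/-- The parameter of the junction is below the prong-box bound of `jin + 1`. [folklore] -/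
theorem β_le_βbox_succ : d.β ≤ d.βbox (d.jin + 1) := (min_le_right _ _).trans ((min_le_right _ _).trans (min_le_left _ _))

/-- The parameter of the junction is below the prong-box bound of `jin - 1`. [folklore] -/
theorem β_le_βbox_pred : d.β ≤ d.βbox (d.jin - 1) := (min_le_right _ _).trans ((min_le_right _ _).trans (min_le_right _ _))

/-- A prong box exists at the incoming prong point. [folklore] -/
theorem nonempty_Kin : Nonempty (ProngBox d.P hι d.jin d.β) := (d.βbox_spec _).2 _ ⟨d.β_pos, d.β_le_βbox_jin⟩

/-- A prong box exists at the outgoing prong point. [folklore] -/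
theorem nonempty_Kout (s : ℝ) : Nonempty (ProngBox d.P hι (d.jout s) d.β) := by
  rcases d.jout_eq_or s with h | h <;> rw [h]
  · exact (d.βbox_spec _).2 _ ⟨d.β_pos, d.β_le_βbox_succ⟩
  · exact (d.βbox_spec _).2 _ ⟨d.β_pos, d.β_le_βbox_pred⟩

/-- The chosen prong box at the incoming prong point (independent of the side). [folklore] -/
def Kin : ProngBox d.P hι d.jin d.β := Classical.choice d.nonempty_Kin

/-- The chosen prong box at the outgoing prong point. [folklore] -/
def Kout (s : ℝ) : ProngBox d.P hι (d.jout s) d.β := Classical.choice (d.nonempty_Kout s)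

/-- **The junction of the state** on the side `s`. [folklore] -/
def junction (s : ℝ) : D.WalkJunction hι := ⟨d.v, d.hv, d.jin, d.jout s, d.β, d.hβ, d.Kin, d.Kout s⟩

/-- The junction is at the arrival saddle. [folklore] -/
@[simp] theorem junction_v (s : ℝ) : (d.junction s).v = d.v := rfl
/-- The junction is at a saddle. [folklore] -/
@[simp] theorem junction_hv (s : ℝ) : (d.junction s).hv = d.hv := rfl
/-- The incoming prong of the junction. [folklore] -/
@[simp] theorem junction_jin (s : ℝ) : (d.junction s).jin = d.jin := rfl
/-- The outgoing prong of the junction. [folklore] -/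
@[simp] theorem junction_jout (s : ℝ) : (d.junction s).jout = d.jout s := rfl
/-- The parameter of the junction. [folklore] -/
@[simp] theorem junction_β (s : ℝ) : (d.junction s).β = d.β := rfl
/-- The incoming box of the junction. [folklore] -/
@[simp] theorem junction_Kin (s : ℝ) : (d.junction s).Kin = d.Kin := rfl
/-- The outgoing box of the junction. [folklore] -/
@[simp] theorem junction_Kout (s : ℝ) : (d.junction s).Kout = d.Kout s := rfl

/-- **The junction turns to the side `s`.** [folklore] -/
theorem junction_turn (s : ℝ) : (d.junction s).jout = (d.junction s).turn s := rfl

/-- The base point of the incoming box lies on the state's leaf (on the arrival tail). [folklore] -/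
theorem Kin_base_mem_leaf : d.Kin.base ∈ F.leaf d.st.y := d.E.lift_mem_leaf hι d.β_mem_Ioc

/-- The base point of the incoming box is a frontier point. [folklore] -/
theorem ι_Kin_base_mem_frontier : ι d.Kin.base ∈ frontier (Dlim ι F K) :=
  H.frontier_of_mem_leaf d.st.hy d.Kin_base_mem_leaf

/-- The incoming prong point is a frontier point. [folklore] -/
theorem pt_mem_frontier : d.P.pt d.jin (d.β, 0) ∈ frontier (Dlim ι F K) := by
  rw [← d.Kin.ι_base]; exact d.ι_Kin_base_mem_frontier

/-! ### Goodness and the next state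

The state `d` is **good** on the side `s` when its out-dart is good: `(d.outDart s).Good hι hbi K`. -/

/-- **The next state** of a good state: the canonical data of the exit point of the out-dart.
[folklore] -/
def next (s : ℝ) (hg : (d.outDart s).Good hι hbi K) : HugData H := (d.outDart s).nextData H hg

/-- **The next state depends only on the out-dart.** [folklore] -/
theorem next_eq_of_outDart_eq {d d' : HugData H} {s : ℝ} (h : d.outDart s = d'.outDart s) (hg : (d.outDart s).Good hι hbi K) (hg' : (d'.outDart s).Good hι hbi K) :
    d.next s hg = d'.next s hg' := by
  unfold next
  have : ∀ (dt dt' : D.Dart) (_ : dt = dt') (h₁ : dt.Good hι hbi K) (h₂ : dt'.Good hι hbi K), dt.nextData H h₁ = dt'.nextData H h₂ := by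
    rintro dt _ rfl _ _; rfl
  exact this _ _ h hg hg'

/-- The next state's point is the exit point of the out-dart. [folklore] -/
theorem next_y (s : ℝ) (hg : (d.outDart s).Good hι hbi K) : (d.next s hg).st.y = d.P.horiz hι (d.jout s) 0 d.P.ρ := rfl

/-- The next state's point lies over the end of the outgoing prong arc. [folklore] -/
theorem ι_next_y (s : ℝ) (hg : (d.outDart s).Good hι hbi K) : ι (d.next s hg).st.y = d.P.pt (d.jout s) (d.P.ρ, 0) := (d.outDart s).ι_exitPt hι

/-- The outgoing prong arc lies in the next leaf. [folklore] -/
theorem horiz_mem_leaf_next (s : ℝ) (hg : (d.outDart s).Good hι hbi K) {b : ℝ} (hb : b ∈ Ioc 0 d.P.ρ) :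
    d.P.horiz hι (d.jout s) 0 b ∈ F.leaf (d.next s hg).st.y :=
  (d.outDart s).horiz_mem_leaf_exitPt hι hb

/-- The next arrival saddle is the ω-saddle of the exit point. [folklore] -/
theorem next_v (s : ℝ) (hg : (d.outDart s).Good hι hbi K) : (d.next s hg).v = H.vω hg.fr := rfl

/-- **The α-limit set of the next leaf is the present saddle.** [folklore] -/
theorem alphaSet_next (s : ℝ) (hg : (d.outDart s).Good hι hbi K) : alphaSet hbi ι (d.next s hg).st.y = {d.v} := hg.α

/-- The canonical tail of the next state is based after its base point. [folklore] -/
theorem base_lt_next_p (s : ℝ) (hg : (d.outDart s).Good hι hbi K) : leafLT hbi (Leaf.base F (d.next s hg).st.y) (d.next s hg).E.p :=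
  HugState.base_lt_canonData_p (H := H) ⟨(d.outDart s).exitPt hι, hg.fr⟩

/-! ### The link to the next state -/

section Link

variable (s : ℝ) (hg : (d.outDart s).Good hι hbi K)

/-- The backward tail of the next leaf along the whole outgoing prong arc. [folklore] -/
def Eb : d.P.BwdTail hbi (d.next s hg).st.y := hg.eb.choose

/-- The backward tail is on the outgoing prong. [folklore] -/
theorem Eb_j : (d.Eb s hg).j = d.jout s := hg.eb.choose_spec.1

/-- The backward tail is the whole prong arc. [folklore] -/
theorem Eb_β₀ : (d.Eb s hg).β₀ = d.P.ρ := hg.eb.choose_spec.2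

/-- The base point of the backward tail is the base point of the next leaf. [folklore] -/
theorem Eb_p : (d.Eb s hg).p = Leaf.base F (d.next s hg).st.y := by
  apply Leaf.injective_coe F (d.next s hg).st.y
  apply hι.injective
  show ι (Leaf.pt (d.Eb s hg).p) = ι (d.next s hg).st.y
  rw [(d.Eb s hg).hp, d.Eb_j, d.Eb_β₀, d.ι_next_y]

/-- The base point of the outgoing box lies on the next leaf. [folklore] -/
theorem Kout_base_mem_leaf : (d.Kout s).base ∈ F.leaf (d.next s hg).st.y := by
  have h := (d.Eb s hg).lift_mem_leaf hι (β := d.β) (by rw [d.Eb_β₀]; exact d.β_mem_Ioc_ρ)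
  rw [d.Eb_j] at h
  exact h

/-- **The start of the link**: the point of the next leaf over the outgoing prong point. [folklore] -/
def linkStart : F.Leaf (d.next s hg).st.y := Leaf.mk (d.Kout s).base (d.Kout_base_mem_leaf s hg)

/-- The start of the link is the base point of the outgoing box. [folklore] -/
@[simp] theorem pt_linkStart : Leaf.pt (d.linkStart s hg) = (d.Kout s).base := rfl

/-- The start of the link is not after the base point of the next leaf. [folklore] -/
theorem not_lt_linkStart : ¬ leafLT hbi (Leaf.base F (d.next s hg).st.y) (d.linkStart s hg) := by
  have h : d.linkStart s hg ∈ bwd hbi (d.Eb s hg).p :=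
    ((d.Eb s hg).bwd_iff _).2 ⟨d.β, by rw [d.Eb_β₀]; exact d.β_mem_Ioc_ρ, by rw [d.pt_linkStart, (d.Kout s).ι_base, d.Eb_j]⟩
  rw [d.Eb_p] at h
  exact h

/-- **The end of the link**: the point of the next leaf over the next incoming prong point. [folklore] -/
def linkEnd : F.Leaf (d.next s hg).st.y := Leaf.mk (d.next s hg).Kin.base (d.next s hg).Kin_base_mem_leaf

/-- The end of the link is the base point of the next incoming box. [folklore] -/
@[simp] theorem pt_linkEnd : Leaf.pt (d.linkEnd s hg) = (d.next s hg).Kin.base := rfl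

/-- The end of the link is not before the base of the next tail. [folklore] -/
theorem not_linkEnd_lt : ¬ leafLT hbi (d.linkEnd s hg) (d.next s hg).E.p :=
  ((d.next s hg).E.fwd_iff _).2 ⟨(d.next s hg).β, (d.next s hg).β_mem_Ioc, by rw [d.pt_linkEnd, (d.next s hg).Kin.ι_base]; rfl⟩

/-- **The link runs forward**: the tails were chosen apart. [folklore] -/
theorem linkStart_lt_linkEnd : leafLT hbi (d.linkStart s hg) (d.linkEnd s hg) := by
  have h₁ := d.not_lt_linkStart s hg
  have h₂ := d.base_lt_next_p s hg
  have h₃ := d.not_linkEnd_lt s hg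
  have h₁₂ : leafLT hbi (d.linkStart s hg) (d.next s hg).E.p := by
    rcases not_leafLT_iff.1 h₁ with h | h
    · exact leafLT_trans h h₂
    · rw [h]; exact h₂
  rcases not_leafLT_iff.1 h₃ with h | h
  · exact leafLT_trans h₁₂ h
  · rw [← h]; exact h₁₂

/-- **The link**: the leaf arc of the next leaf from the outgoing prong point to the next incoming
prong point. [folklore] -/
def link : Path (d.junction s).Kout.base ((d.next s hg).junction s).Kin.base :=
  (exists_leafIccPath (d.linkStart_lt_linkEnd s hg)).choose

/-- The properties of the link: continuous in the leaf topology, injective, with range the closed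
leaf interval between its ends. [folklore] -/
theorem link_spec :
    Continuous (toLeafSpace ∘ d.link s hg : I → F.LeafSpace) ∧ Injective (d.link s hg) ∧
      ∀ y, y ∈ range (d.link s hg) ↔ ∃ r ∈ leafIcc hbi (d.linkStart s hg) (d.linkEnd s hg), Leaf.pt r = y :=
  (exists_leafIccPath (d.linkStart_lt_linkEnd s hg)).choose_spec

/-- The link is continuous in the leaf topology. [folklore] -/
theorem continuous_toLeafSpace_link : Continuous (toLeafSpace ∘ d.link s hg : I → F.LeafSpace) := (d.link_spec s hg).1

/-- The link is injective. [folklore] -/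
theorem injective_link : Injective (d.link s hg) := (d.link_spec s hg).2.1

/-- The points of the link are on the next leaf. [folklore] -/
theorem link_mem_leaf (θ : I) : d.link s hg θ ∈ F.leaf (d.next s hg).st.y := by
  obtain ⟨r, -, hr⟩ := ((d.link_spec s hg).2.2 _).1 ⟨θ, rfl⟩
  rw [← hr]; exact r.2

end Link

end HugData

/-! ## A path inside the star between the two prong points of a junction -/

namespace WalkJunction

variable (J₀ : D.WalkJunction hι) {s : ℝ} (hs : s = 1 ∨ s = -1) (hturn : J₀.jout = J₀.turn s) (hβ0 : 0 < J₀.β)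

/-- The height of the junk path: `s ρ / 2`. [folklore] -/
def junkHt (s : ℝ) : ℝ := s * ((D.star _ J₀.hv).ρ / 2)

omit [T2Space X] [SecondCountableTopology X] in
include hs in
/-- The height of the junk path is in `[-ρ, ρ]`. [folklore] -/
theorem junkHt_mem : J₀.junkHt s ∈ Icc (-(D.star _ J₀.hv).ρ) (D.star _ J₀.hv).ρ := by
  have hρ := (D.star _ J₀.hv).ρ_pos
  unfold junkHt; rcases hs with rfl | rfl <;> constructor <;> linarith

omit [T2Space X] [SecondCountableTopology X] in
include hs in
/-- The height of the junk path has the sign `s`. [folklore] -/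
theorem mul_junkHt_pos : 0 < s * J₀.junkHt s := by
  have hρ := (D.star _ J₀.hv).ρ_pos
  unfold junkHt; rcases hs with rfl | rfl <;> linarith

omit [T2Space X] [SecondCountableTopology X] in
include hs in
/-- The height of the junk path is not zero. [folklore] -/
theorem junkHt_ne_zero : J₀.junkHt s ≠ 0 := fun h ↦ by
  have := J₀.mul_junkHt_pos hs; rw [h, mul_zero] at this; exact lt_irrefl _ this

/-- The planar out-leg: from `pt jout (β, 0)` to the axis point `pt jout (0, s ρ / 2)`. [folklore] -/
def junkOut (s : ℝ) (u : I) : ℝ × ℝ := ((1 - u) * J₀.β, u * J₀.junkHt s)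

/-- The planar in-leg: from the axis point `pt jin (0, s ρ / 2)` to `pt jin (β, 0)`. [folklore] -/
def junkIn (s : ℝ) (u : I) : ℝ × ℝ := (u * J₀.β, (1 - u) * J₀.junkHt s)

omit [T2Space X] [SecondCountableTopology X] in
include hs in
/-- The out-leg has coordinates in the half square. [folklore] -/
theorem junkOut_mem (u : I) : J₀.junkOut s u ∈ (D.star _ J₀.hv).rect := by
  have hρ := (D.star _ J₀.hv).ρ_pos
  have hh := J₀.junkHt_mem hs
  have hu0 := u.2.1; have hu1 := u.2.2
  refine ((D.star _ J₀.hv).mem_rect_iff).2 ⟨⟨by unfold junkOut; nlinarith [J₀.hβ.1], ?_⟩, ?_, ?_⟩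
  · unfold junkOut; nlinarith [J₀.hβ.2, J₀.hβ.1]
  · unfold junkOut; nlinarith [hh.1, hh.2]
  · unfold junkOut; nlinarith [hh.1, hh.2]

omit [T2Space X] [SecondCountableTopology X] in
include hs in
/-- The in-leg has coordinates in the half square. [folklore] -/
theorem junkIn_mem (u : I) : J₀.junkIn s u ∈ (D.star _ J₀.hv).rect := by
  have hρ := (D.star _ J₀.hv).ρ_pos
  have hh := J₀.junkHt_mem hs
  have hu0 := u.2.1; have hu1 := u.2.2
  refine ((D.star _ J₀.hv).mem_rect_iff).2 ⟨⟨by unfold junkIn; nlinarith [J₀.hβ.1], ?_⟩, ?_, ?_⟩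
  · unfold junkIn; nlinarith [J₀.hβ.2, J₀.hβ.1]
  · unfold junkIn; nlinarith [hh.1, hh.2]
  · unfold junkIn; nlinarith [hh.1, hh.2]

omit [T2Space X] [SecondCountableTopology X] in
include hs hβ0 in
/-- The out-leg avoids the origin of the coordinates. [folklore] -/
theorem junkOut_ne (u : I) : J₀.junkOut s u ≠ 0 := fun h ↦ by
  have h1 := congrArg Prod.fst h; have h2 := congrArg Prod.snd h
  simp only [junkOut, Prod.fst_zero, Prod.snd_zero, mul_eq_zero] at h1 h2
  rcases h1 with h1 | h1
  · rcases h2 with h2 | h2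
    · have : (u : ℝ) = 1 := by linarith
      rw [this] at h2; exact one_ne_zero h2
    · exact J₀.junkHt_ne_zero hs h2
  · exact hβ0.ne' h1

omit [T2Space X] [SecondCountableTopology X] in
include hs hβ0 in
/-- The in-leg avoids the origin of the coordinates. [folklore] -/
theorem junkIn_ne (u : I) : J₀.junkIn s u ≠ 0 := fun h ↦ by
  have h1 := congrArg Prod.fst h; have h2 := congrArg Prod.snd h
  simp only [junkIn, Prod.fst_zero, Prod.snd_zero, mul_eq_zero] at h1 h2
  rcases h1 with h1 | h1
  · rcases h2 with h2 | h2
    · have : (u : ℝ) = 1 := by linarith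
      rw [h1] at this; exact zero_ne_one this
    · exact J₀.junkHt_ne_zero hs h2
  · exact hβ0.ne' h1

omit [T2Space X] [SecondCountableTopology X] in
/-- A planar path in the half square off the origin lifts to a continuous path of `X`. [folklore] -/
theorem continuous_lift_pt {v : ℂ} {n : ℕ} (P : ProngStar F ι v n) (j : ZMod n) {f : I → ℝ × ℝ} (hf : Continuous f)
    (hmem : ∀ u, f u ∈ P.rect) (hne : ∀ u, f u ≠ 0) : Continuous fun u ↦ ProngStar.lift hι (P.pt j (f u)) := by
  have h1 : Continuous fun u ↦ P.pt j (f u) :=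
    ((P.continuousOn_pt j).comp_continuous hf hmem)
  refine (ProngStar.continuousOn_lift hι).comp_continuous h1 fun u ↦ ?_
  exact P.diff_subset_range j ⟨P.pt_mem (hmem u), P.pt_ne (hmem u) (hne u)⟩

/-- The out-leg of the junk path, in `X`. [folklore] -/
def junkOutPath : Path J₀.Kout.base (ProngStar.lift hι ((D.star _ J₀.hv).pt J₀.jout (0, J₀.junkHt s))) where
  toFun u := ProngStar.lift hι ((D.star _ J₀.hv).pt J₀.jout (J₀.junkOut s u))
  continuous_toFun :=
    continuous_lift_pt (hι := hι) _ _ (by unfold junkOut; fun_prop) (J₀.junkOut_mem hs) (J₀.junkOut_ne hs hβ0)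
  source' := by simp only [junkOut, Icc.coe_zero, sub_zero, one_mul, zero_mul]; rfl
  target' := by simp only [junkOut, Icc.coe_one, sub_self, zero_mul, one_mul]

/-- The in-leg of the junk path, in `X`. [folklore] -/
def junkInPath : Path (ProngStar.lift hι ((D.star _ J₀.hv).pt J₀.jin (0, J₀.junkHt s))) J₀.Kin.base where
  toFun u := ProngStar.lift hι ((D.star _ J₀.hv).pt J₀.jin (J₀.junkIn s u))
  continuous_toFun :=
    continuous_lift_pt (hι := hι) _ _ (by unfold junkIn; fun_prop) (J₀.junkIn_mem hs) (J₀.junkIn_ne hs hβ0)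
  source' := by simp only [junkIn, Icc.coe_zero, zero_mul, sub_zero, one_mul]
  target' := by simp only [junkIn, Icc.coe_one, one_mul, sub_self, zero_mul]; rfl

omit [T2Space X] [SecondCountableTopology X] in
include hs hturn in
/-- The two legs meet on the axis. [folklore] -/
theorem junk_mid : ProngStar.lift hι ((D.star _ J₀.hv).pt J₀.jout (0, J₀.junkHt s)) =
    ProngStar.lift hι ((D.star _ J₀.hv).pt J₀.jin (0, J₀.junkHt s)) := by
  rw [hturn, ← J₀.nb_eq_turn hs (J₀.mul_junkHt_pos hs), (D.star _ J₀.hv).pt_nb_zero (J₀.junkHt_mem hs)]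

/-- **The junk path** of a junction turning to the side `s` with `β > 0`: inside the star, from the
outgoing prong point through the axis point at height `s ρ / 2` to the incoming prong point
(continuous, not leafwise). [folklore] -/
def junkPath : Path J₀.Kout.base J₀.Kin.base :=
  (J₀.junkOutPath hs hβ0).trans ((J₀.junkInPath hs hβ0).cast (J₀.junk_mid hs hturn) rfl)

end WalkJunction

/-! ## The sequence of states, the junctions and the links of the hugged walk -/

namespace HugData

variable {H}

open scoped Classical in
/-- **The sequence of states** of the hugged walk from `d₀` on the side `s`: the next state while
good, constant afterwards. [folklore] -/
def seq (s : ℝ) (d₀ : HugData H) : ℕ → HugData H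
  | 0 => d₀
  | k + 1 => if hg : ((seq s d₀ k).outDart s).Good hι hbi K then (seq s d₀ k).next s hg else seq s d₀ k

variable (s : ℝ) (d₀ : HugData H)

/-- The sequence starts at `d₀`. [folklore] -/
@[simp] theorem seq_zero : seq s d₀ 0 = d₀ := rfl

open scoped Classical in
/-- The recursion of the sequence of states. [folklore] -/
theorem seq_succ (k : ℕ) :
    seq s d₀ (k + 1) = if hg : ((seq s d₀ k).outDart s).Good hι hbi K then (seq s d₀ k).next s hg else seq s d₀ k := rfl

/-- After a good state comes its next state. [folklore] -/
theorem seq_succ_of_good {k : ℕ} (hg : ((seq s d₀ k).outDart s).Good hι hbi K) : seq s d₀ (k + 1) = (seq s d₀ k).next s hg := by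
  rw [seq_succ, dif_pos hg]

/-- After a state that is not good the sequence stays. [folklore] -/
theorem seq_succ_of_not_good {k : ℕ} (hg : ¬ ((seq s d₀ k).outDart s).Good hι hbi K) : seq s d₀ (k + 1) = seq s d₀ k := by
  rw [seq_succ, dif_neg hg]

/-- **The out-darts evolve autonomously**: the out-dart of the next state is a function of the
out-dart. [folklore] -/
theorem outDart_seq_succ_eq {k k' : ℕ} (h : (seq s d₀ k).outDart s = (seq s d₀ k').outDart s)
    (hg : ((seq s d₀ k).outDart s).Good hι hbi K) (hg' : ((seq s d₀ k').outDart s).Good hι hbi K) : seq s d₀ (k + 1) = seq s d₀ (k' + 1) := by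
  rw [seq_succ_of_good s d₀ hg, seq_succ_of_good s d₀ hg']
  exact next_eq_of_outDart_eq h hg hg'

end HugData

section Walk

variable {H} (s : ℝ) (hs : s = 1 ∨ s = -1) (d₀ : HugData H)

/-- **The junctions of the hugged walk.** [folklore] -/
def hugJ (k : ℕ) : D.WalkJunction hι := (HugData.seq s d₀ k).junction s

/-- **The hugged walk turns to the side `s` at every junction.** [folklore] -/
theorem hugJ_turn (k : ℕ) : (hugJ s d₀ k).jout = (hugJ s d₀ k).turn s := rfl

/-- The saddle of the junction `k`. [folklore] -/
@[simp] theorem hugJ_v (k : ℕ) : (hugJ s d₀ k).v = (HugData.seq s d₀ k).v := rfl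
/-- The incoming prong of the junction `k`. [folklore] -/
@[simp] theorem hugJ_jin (k : ℕ) : (hugJ s d₀ k).jin = (HugData.seq s d₀ k).jin := rfl
/-- The outgoing prong of the junction `k`. [folklore] -/
@[simp] theorem hugJ_jout (k : ℕ) : (hugJ s d₀ k).jout = (HugData.seq s d₀ k).jout s := rfl
/-- The parameter of the junction `k`. [folklore] -/
@[simp] theorem hugJ_β (k : ℕ) : (hugJ s d₀ k).β = (HugData.seq s d₀ k).β := rfl
/-- The incoming box of the junction `k`. [folklore] -/
@[simp] theorem hugJ_Kin (k : ℕ) : (hugJ s d₀ k).Kin = (HugData.seq s d₀ k).Kin := rfl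

open scoped Classical in
/-- **The links of the hugged walk**: the leaf-arc link at a good index, the junk path otherwise.
[folklore] -/
def hugLink (k : ℕ) : Path (hugJ s d₀ k).Kout.base (hugJ s d₀ (k + 1)).Kin.base :=
  if hg : ((HugData.seq s d₀ k).outDart s).Good hι hbi K then
    ((HugData.seq s d₀ k).link s hg).cast rfl (by unfold hugJ; rw [HugData.seq_succ_of_good s d₀ hg])
  else
    (WalkJunction.junkPath _ hs rfl (HugData.seq s d₀ k).β_pos).cast rfl
      (by unfold hugJ; rw [HugData.seq_succ_of_not_good s d₀ hg])

/-- At a good index the link is the leaf-arc link. [folklore] -/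
theorem hugLink_apply_of_good {k : ℕ} (hg : ((HugData.seq s d₀ k).outDart s).Good hι hbi K) (θ : I) :
    hugLink s hs d₀ k θ = (HugData.seq s d₀ k).link s hg θ := by
  unfold hugLink; rw [dif_pos hg]; rfl

/-- **At a good index the link is continuous in the leaf topology.** [folklore] -/
theorem continuous_toLeafSpace_hugLink {k : ℕ} (hg : ((HugData.seq s d₀ k).outDart s).Good hι hbi K) :
    Continuous (toLeafSpace ∘ hugLink s hs d₀ k : I → F.LeafSpace) := by
  have : (toLeafSpace ∘ hugLink s hs d₀ k : I → F.LeafSpace) = toLeafSpace ∘ (HugData.seq s d₀ k).link s hg := by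
    funext θ; simp only [comp_apply, hugLink_apply_of_good s hs d₀ hg]
  rw [this]; exact (HugData.seq s d₀ k).continuous_toLeafSpace_link s hg

/-- At a good index the points of the link lie on the next leaf. [folklore] -/
theorem hugLink_mem_leaf {k : ℕ} (hg : ((HugData.seq s d₀ k).outDart s).Good hι hbi K) (θ : I) :
    hugLink s hs d₀ k θ ∈ F.leaf (HugData.seq s d₀ (k + 1)).st.y := by
  rw [hugLink_apply_of_good s hs d₀ hg, HugData.seq_succ_of_good s d₀ hg]
  exact (HugData.seq s d₀ k).link_mem_leaf s hg θ

end Walk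

end StarData

end Literature.Topology.PlanarFoliations
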